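import Literature.IUT.HodgeArakelov.ThetaEvaluationSubgraphs
import Literature.IUT.HodgeArakelov.ZeroLabelSplitting
import HarnessLib

/-!
# [IUTchII] Corollaries 2.5 (i)(ii), 2.6 (ii): kernel edges between the concrete theta-value kernel
# (`thetaValueAt`), the orbit calculus of Cor. 2.8 (`ThetaValueOrbits`) and the zero-label splitting

Proof-only companion (abc-iut cell, layer L6, wave-4 discharge seat abc-iut-w4-d005 gen 4; nodes
**IUTchII:Cor2.5(i)**, **IUTchII:Cor2.5(ii)**, **IUTchII:Cor2.6(ii)** — CLAIM verify 2026-08-26T07:1xZ) of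
abc-iut-L6-t2's statement file `Literature/IUT/HodgeArakelov/ThetaEvaluationSubgraphs.lean` (p404618), of
abc-iut-L6-t4's `ThetaValueOrbits.lean` (p404347; companion p405745 `ThetaValueOrbitsProofs`, abc-iut-L6-d1) and
of abc-iut-L6-d1's `ZeroLabelSplitting.lean` (p407386). NO new definitions.

S. Mochizuki, *Inter-universal Teichmüller theory II*, kurims manuscript (Dec. 2020) [claim key Mochizuki2012,
status disputed (D-0012)], read on the cell render `lit/renders/IUTchII-kurims-url-5036b4059555`:
* Cor. 2.5 (i) p. 71 l. 33–37: "Write `(l·Δ_Θ)(Π_{v⩒▶})` for the subquotient of `Π_{v⩒▶}` determined by the subquotient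
  `(l·Δ_Θ)(Π_v)` of `Π_v`. Then the inclusion `Π_{v⩒▶} ↪ Π_v` induces an isomorphism `(l·Δ_Θ)(Π_{v⩒▶}) ⥲ (l·Δ_Θ)(Π_v)`";
  proof p. 72 l. 35–38: "follows immediately by considering the cuspidal inertia groups involved".
* Cor. 2.5 (ii) pp. 71–72: restriction "yields `μ_{2l}`-, `μ`-orbits of elements `θ^t(Π^γ_{v⩒▶}) ⊆ ∞θ^t(Π^γ_{v⩒▶})`";
  "the sets `θ^t(Π^γ_{v⩒▶})`, `∞θ^t(Π^γ_{v⩒▶})` depend only on the label `|t| ∈ |𝔽_l|` determined by `t`. Thus, we shall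
  write `θ^{|t|}(Π^γ_{v⩒▶}) := θ^t(Π^γ_{v⩒▶})`"; Rmk. 2.5.1 (i) p. 72: "the set `θ^j(Π_{v⩒▶})` consists of precisely the
  `μ_{2l}`-orbit of the theta value `q_v^{j²}` … where the `j` in the exponent denotes the element `∈ {0, 1, …, l⋇}`
  determined by the given element `j ∈ |𝔽_l|`" (the representative of absolute value `≤ l⋇`, Rmk. 2.8.3 (i) p. 83).
* Cor. 2.6 (ii) p. 76: "suppose that `t` is taken to be the zero element. Then the set `θ^t(Π^γ_{v⩒▶})` (respectively,
  `∞θ^t(Π^γ_{v⩒▶})`) is equal to the `μ_{2l}`- (respectively, `μ`-) orbit of the identity element [i.e., the zero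
  element of cohomology module in question, if one denotes the module structure additively]. In particular,
  … restriction to the decomposition groups `D^δ_{t,μ_-}` … determines splittings
  `M^{×μ}_TM(Π^γ_{v⩒▶}) × {∞θ^ι(Π^γ_{v⩒▶})/M^μ_TM(Π^γ_{v⩒▶})}` of `M^×_TM·∞θ^ι(Π^γ_{v⩒▶})/M^μ_TM(Π^γ_{v⩒▶})`".

WHAT IS PROVED (elementary group theory; every quoted sentence carries the disputed claim key, nothing is
asserted about the disputed inference of [IUTchIII] Cor. 3.12):
* §1 **Cor. 2.5 (i), the printed reason made precise** (`Subquotient.inf_sup_bot_eq_top_of_generators`,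
  `Subquotient.top_le_inf_sup_bot_of_generators`): abc-iut-L6-t2's bookkeeping `Subquotient.inf_eq_of_le` needs
  ALL of the top group of the subquotient inside `Π_{v⩒▶}`; print only uses that the top group is GENERATED, over the
  bottom group, by subgroups lying in `Π_{v⩒▶}` ("the cuspidal inertia groups involved", Cor. 2.4 (ii):
  `I^δ_t ⊆ Π^δ_{v⩒▶}`). Under exactly that hypothesis `(top ⊓ Π_{v⩒▶}) ⊔ bot = top`, i.e. the map of subquotients
  `(top ⊓ Π_{v⩒▶})/(bot ⊓ Π_{v⩒▶}) → top/bot` induced by the inclusion is onto (it is always into): the printed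
  "induces an isomorphism".
* §2 **Cor. 2.5 (ii) "`μ_{2l}`-orbits of elements" / torsor form** (`mem_thetaValueAt_iff_pow_eq_one`,
  `mul_mem_thetaValueAt_iff`): membership in `θ^j = μ_{2l}·q^{j²}` is "`x/q^{j²}` is a `2l`-th root of unity", and
  `θ^j` is stable exactly under multiplication by `2l`-th roots of unity.
* §3 **Cor. 2.5 (ii) "depend only on the label `|t| ∈ |𝔽_l|`"** at the concrete kernel
  (`thetaValueAt_label_neg`, `thetaValueAt_label_eq_of_abs_eq`): indexing the theta values by the representative
  `j(t) = |t.valMinAbs| ∈ {0, …, l⋇}` of a label `t ∈ 𝔽_l` (Rmk. 2.5.1 (i) / Rmk. 2.8.3 (i)), `θ^{j(−t)} = θ^{j(t)}`, so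
  `θ^{|t|}` is well defined on `|𝔽_l| = 𝔽_l/{±1}`.
* §4 **the junction with abc-iut-L6-t4's orbit calculus** (`ofMul_image_thetaValueAt`): read additively
  (`Additive H`, "if one denotes the module structure additively", Cor. 2.6 (ii)), the concrete kernel `θ^j` IS
  the `μ_{2l}`-orbit `ThetaValueOrbits.mu2lOrbit 2l (q^{j²})` of Cor. 2.8 (i)'s output signature — the kernel edge
  behind Rmk. 2.8.1 ("Corollaries 2.5, 2.6 as the special case `𝕄^Θ_* = 𝕄^Θ_*(Π_v)`", p405745
  `ThetaValueOrbits.rmk281_canonical`).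
* §5 **Cor. 2.6 (ii)**: at the zero label the concrete kernel is the `μ_{2l}`-orbit of the identity
  (`ofMul_image_thetaValueAt_zero` = `mu2lOrbit 2l 0`, additive form of p404618 `thetaValueAt_zero`), every theta
  value at the zero label is `2l`-torsion / of finite order (`pow_eq_one_of_mem_thetaValueAt_zero`,
  `isOfFinOrder_of_mem_thetaValueAt_zero`, `isOfFinAddOrder_of_mem_thetaValueAt_zero`), and hence the hypothesis
  `hS` ("the restriction kills the theta classes modulo torsion") of abc-iut-L6-d1's zero-label splitting
  (`ThetaValueOrbits.torsion_restrict_iff` / `zeroLabel_decomp_unique` / `zeroLabel_unit_component`, p407386) is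
  DISCHARGED whenever the restriction to `D^δ_{0,μ_-}` lands in `θ^0` (`zeroLabel_hS_of_thetaValueAt_zero`,
  `zeroLabel_torsion_restrict_iff_of_thetaValueAt_zero`): the "In particular" of Cor. 2.6 (ii) as a kernel edge.

HONEST SCOPE: the group-theoretic CONSTRUCTION of the restriction maps to `Π^γ_{v⩒▶}` and to `D^δ_{t,μ_-}` from a
projective system of mono-theta environments / from `Π_v` (Props. 2.1, 2.2, Cor. 2.4; abc-iut-L6-t1's
`TemperedCoverings` / `SubgraphDecomposition` / `IotaInvariantTheta` / `TwoTorsionTranslates`) enters, as in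
p405745, only through abstract homomorphisms `res`; nothing here identifies a cohomology module of that frame with
the concrete kernel `H`. Typed ≠ endorsed; no side taken on [IUTchIII] Cor. 3.12.
-/

namespace Literature.IUT.HodgeArakelov

universe u v

/-! ### 1. Cor. 2.5 (i): "by considering the cuspidal inertia groups involved" -/

section Cor25i

variable {Q : Type v} [Group Q]

/-- **IUTchII:Cor2.5(i)** (kurims p. 71 l. 35–37, proof p. 72 l. 35–38): if the top group of the subquotient
`(l·Δ_Θ)(Π_v) = top/bot` is generated over `bot` by a family of subgroups `I i` ("the cuspidal inertia groups
involved") each of which lies in `Π_{v⩒▶}` (Cor. 2.4 (ii): `I^δ_t ⊆ Π^δ_{v⩒▶}`), then `(top ⊓ Π_{v⩒▶}) ⊔ bot = top`: the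
subquotient of `Π_{v⩒▶}` "determined by" `(l·Δ_Θ)(Π_v)` maps ONTO `(l·Δ_Θ)(Π_v)` — "the inclusion `Π_{v⩒▶} ↪ Π_v` induces
an isomorphism `(l·Δ_Θ)(Π_{v⩒▶}) ⥲ (l·Δ_Θ)(Π_v)`" (injectivity of the induced map of subquotients is automatic).
[claim: Mochizuki2012, status: disputed] -/
theorem Subquotient.inf_sup_bot_eq_top_of_generators (S : Subquotient Q) (H : Subgroup Q) {ι : Type*}
    (I : ι → Subgroup Q) (hgen : S.top = S.bot ⊔ ⨆ i, I i) (hI : ∀ i, I i ≤ H) :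
    (S.top ⊓ H) ⊔ S.bot = S.top := by
  apply le_antisymm
  · exact sup_le inf_le_left S.le
  · have hIt : (⨆ i, I i) ≤ S.top := by
      rw [hgen]; exact le_sup_right
    have hIH : (⨆ i, I i) ≤ H := iSup_le hI
    calc S.top = S.bot ⊔ ⨆ i, I i := hgen
      _ ≤ S.bot ⊔ (S.top ⊓ H) := sup_le_sup_left (le_inf hIt hIH) _
      _ = (S.top ⊓ H) ⊔ S.bot := sup_comm _ _

/-- **IUTchII:Cor2.5(i)** (kurims p. 71), the same as an inclusion `top ≤ (top ⊓ Π_{v⩒▶}) ⊔ bot`: every class of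
`(l·Δ_Θ)(Π_v)` has a representative in `Π_{v⩒▶}`. [claim: Mochizuki2012, status: disputed] -/
theorem Subquotient.top_le_inf_sup_bot_of_generators (S : Subquotient Q) (H : Subgroup Q) {ι : Type*}
    (I : ι → Subgroup Q) (hgen : S.top = S.bot ⊔ ⨆ i, I i) (hI : ∀ i, I i ≤ H) :
    S.top ≤ (S.top ⊓ H) ⊔ S.bot :=
  (S.inf_sup_bot_eq_top_of_generators H I hgen hI).ge

/-- **IUTchII:Cor2.5(i)** (kurims p. 71): abc-iut-L6-t2's hypothesis `top ≤ Π_{v⩒▶}` is the special case in which the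
whole top group is among the generators; then both bookkeeping identities of `Subquotient.inf_eq_of_le` hold
and the generator form holds as well. [claim: Mochizuki2012, status: disputed] -/
theorem Subquotient.inf_sup_bot_eq_top_of_le (S : Subquotient Q) (H : Subgroup Q) (h : S.top ≤ H) :
    (S.top ⊓ H) ⊔ S.bot = S.top := by
  rw [(S.inf_eq_of_le H h).1]
  exact sup_eq_left.mpr S.le

end Cor25i

/-! ### 2. Cor. 2.5 (ii): `θ^j` is a `μ_{2l}`-torsor -/

section Cor25ii

variable {H : Type u} [CommGroup H] [DecidableEq H] (twoL : ℕ) [Fintype (rootsOfUnity twoL H)]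

/-- **IUTchII:Cor2.5(ii)** (kurims p. 71 l. 44 – p. 72 l. 1, "`μ_{2l}`-orbits of elements"; Rmk. 2.5.1 (i) p. 72):
`x ∈ θ^j = μ_{2l}·q^{j²}` if and only if `x·(q^{j²})⁻¹` is a `2l`-th root of unity.
[claim: Mochizuki2012, status: disputed] -/
theorem mem_thetaValueAt_iff_pow_eq_one [NeZero twoL] (q : H) (j : ℕ) (x : H) :
    x ∈ thetaValueAt twoL q j ↔ (x * (q ^ (j ^ 2))⁻¹) ^ twoL = 1 := by
  rw [mem_thetaValueAt]
  constructor
  · rintro ⟨ζ, rfl⟩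
    rw [mul_inv_cancel_right, ← Units.val_pow_eq_pow_val, (mem_rootsOfUnity twoL _).mp ζ.2, Units.val_one]
  · intro h
    refine ⟨rootsOfUnity.mkOfPowEq _ h, ?_⟩
    rw [rootsOfUnity.coe_mkOfPowEq, inv_mul_cancel_right]

/-- **IUTchII:Cor2.5(ii)** (kurims p. 71, "`μ_{2l}`-orbits"): `θ^j` is stable under multiplication by `2l`-th roots of
unity, and ONLY by them — for `x ∈ θ^j`, `u·x ∈ θ^j ↔ u^{2l} = 1` (the orbit is a `μ_{2l}`-torsor; cf. p404618
`card_thetaValueAt`). [claim: Mochizuki2012, status: disputed] -/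
theorem mul_mem_thetaValueAt_iff [NeZero twoL] (q : H) (j : ℕ) {x : H} (hx : x ∈ thetaValueAt twoL q j)
    (u : H) : u * x ∈ thetaValueAt twoL q j ↔ u ^ twoL = 1 := by
  rw [mem_thetaValueAt_iff_pow_eq_one] at hx ⊢
  rw [mul_assoc, mul_pow, hx, mul_one]

/-- **IUTchII:Cor2.5(ii)** (kurims p. 71): the theta value `q^{j²}` itself lies in `θ^j`.
[claim: Mochizuki2012, status: disputed] -/
theorem pow_sq_mem_thetaValueAt [NeZero twoL] (q : H) (j : ℕ) : q ^ (j ^ 2) ∈ thetaValueAt twoL q j := by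
  rw [mem_thetaValueAt_iff_pow_eq_one, mul_inv_cancel, one_pow]

end Cor25ii

/-! ### 3. Cor. 2.5 (ii): "depend only on the label `|t| ∈ |𝔽_l|`" -/

section Labels

variable {H : Type u} [CommGroup H] [DecidableEq H] (twoL : ℕ) [Fintype (rootsOfUnity twoL H)]

/-- **IUTchII:Cor2.5(ii)** (kurims p. 72 l. 3–6, "depend only on the label `|t| ∈ |𝔽_l|` … we shall write
`θ^{|t|} := θ^t`") with Rmk. 2.5.1 (i) p. 72 ("the `j` in the exponent denotes the element `∈ {0, 1, …, l⋇}` determined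
by … `j ∈ |𝔽_l|`", i.e. the representative of least absolute value, Rmk. 2.8.3 (i)): the concrete theta values
indexed by `j(t) := |t.valMinAbs|` satisfy `θ^{j(−t)} = θ^{j(t)}` for every label `t ∈ 𝔽_l`.
[claim: Mochizuki2012, status: disputed] -/
theorem thetaValueAt_label_neg {l : ℕ} (q : H) (t : ZMod l) :
    thetaValueAt twoL q (-t).valMinAbs.natAbs = thetaValueAt twoL q t.valMinAbs.natAbs := by
  rw [ZMod.natAbs_valMinAbs_neg]

/-- **IUTchII:Cor2.5(ii)** (kurims p. 72 l. 3–6): labels with the same class in `|𝔽_l| = 𝔽_l/{±1}` (`t' = t` or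
`t' = −t`) have the same concrete theta values — `θ^{|t|}` is well defined.
[claim: Mochizuki2012, status: disputed] -/
theorem thetaValueAt_label_eq_of_abs_eq {l : ℕ} (q : H) {t t' : ZMod l} (h : t' = t ∨ t' = -t) :
    thetaValueAt twoL q t'.valMinAbs.natAbs = thetaValueAt twoL q t.valMinAbs.natAbs := by
  rcases h with rfl | rfl
  · rfl
  · exact thetaValueAt_label_neg twoL q t

/-- **IUTchII:Cor2.5(ii)** / Rmk. 2.5.1 (i) (kurims p. 72): the representative `j(t) = |t.valMinAbs|` of a label of
`𝔽_l`, `l = 2l⋇ + 1`, lies in `{0, 1, …, l⋇}`. [claim: Mochizuki2012, status: disputed] -/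
theorem label_natAbs_valMinAbs_le (lstar : ℕ) (t : ZMod (2 * lstar + 1)) : t.valMinAbs.natAbs ≤ lstar := by
  haveI : NeZero (2 * lstar + 1) := ⟨by omega⟩
  have h := ZMod.natAbs_valMinAbs_le t
  omega

end Labels

/-! ### 4. The junction with `ThetaValueOrbits` (Rmk. 2.8.1): the concrete kernel read additively -/

section Junction

variable {H : Type u} [CommGroup H] [DecidableEq H] (twoL : ℕ) [Fintype (rootsOfUnity twoL H)]

/-- **IUTchII:Cor2.5(ii)** ↔ **IUTchII:Cor2.8(i)** junction (Rmk. 2.8.1 p. 83; Cor. 2.6 (ii) p. 76 "if one denotes the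
module structure additively"): read in `Additive H`, abc-iut-L6-t2's concrete kernel `θ^j = μ_{2l}·q^{j²}` IS
abc-iut-L6-t4's `μ_{2l}`-orbit `ThetaValueOrbits.mu2lOrbit 2l (q^{j²})` (translates by `2l`-torsion classes).
[claim: Mochizuki2012, status: disputed] -/
theorem ofMul_image_thetaValueAt [NeZero twoL] (q : H) (j : ℕ) :
    Additive.ofMul '' (↑(thetaValueAt twoL q j) : Set H) =
      ThetaValueOrbits.mu2lOrbit twoL (Additive.ofMul (q ^ (j ^ 2))) := by
  ext a
  simp only [Set.mem_image, Finset.mem_coe, ThetaValueOrbits.mu2lOrbit, Set.mem_setOf_eq]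
  constructor
  · rintro ⟨x, hx, rfl⟩
    refine ⟨Additive.ofMul (x * (q ^ (j ^ 2))⁻¹), ?_, ?_⟩
    · rw [← ofMul_pow, (mem_thetaValueAt_iff_pow_eq_one twoL q j x).mp hx, ofMul_one]
    · rw [← ofMul_mul, mul_comm x, mul_inv_cancel_left]
  · rintro ⟨τ, hτ, rfl⟩
    refine ⟨q ^ (j ^ 2) * Additive.toMul τ, ?_, ?_⟩
    · rw [mem_thetaValueAt_iff_pow_eq_one, mul_inv_cancel_comm, ← toMul_nsmul, hτ, toMul_zero]
    · rw [ofMul_mul, ofMul_toMul]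

end Junction

/-! ### 5. Cor. 2.6 (ii): the zero label -/

section Cor26ii

variable {H : Type u} [CommGroup H] [DecidableEq H] (twoL : ℕ) [Fintype (rootsOfUnity twoL H)]

/-- **IUTchII:Cor2.6(ii)** (kurims p. 76 l. 28–31): at the zero label every theta value is a `2l`-th root of unity
(`θ^0 = μ_{2l}·q^{0} = μ_{2l}`, p404618 `thetaValueAt_zero`). [claim: Mochizuki2012, status: disputed] -/
theorem pow_eq_one_of_mem_thetaValueAt_zero [NeZero twoL] (q : H) {x : H} (hx : x ∈ thetaValueAt twoL q 0) :
    x ^ twoL = 1 := by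
  have h := (mem_thetaValueAt_iff_pow_eq_one twoL q 0 x).mp hx
  simpa using h

/-- **IUTchII:Cor2.6(ii)** (kurims p. 76): conversely every `2l`-th root of unity lies in `θ^0` — "equal to the
`μ_{2l}`-orbit of the identity element". [claim: Mochizuki2012, status: disputed] -/
theorem mem_thetaValueAt_zero_iff [NeZero twoL] (q : H) (x : H) :
    x ∈ thetaValueAt twoL q 0 ↔ x ^ twoL = 1 := by
  rw [mem_thetaValueAt_iff_pow_eq_one]
  simp

/-- **IUTchII:Cor2.6(ii)** (kurims p. 76): theta values at the zero label have finite order (are torsion).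
[claim: Mochizuki2012, status: disputed] -/
theorem isOfFinOrder_of_mem_thetaValueAt_zero [NeZero twoL] (q : H) {x : H}
    (hx : x ∈ thetaValueAt twoL q 0) : IsOfFinOrder x :=
  isOfFinOrder_iff_pow_eq_one.mpr
    ⟨twoL, Nat.pos_of_ne_zero (NeZero.ne twoL), pow_eq_one_of_mem_thetaValueAt_zero twoL q hx⟩

/-- **IUTchII:Cor2.6(ii)** (kurims p. 76, "the zero element of [the] cohomology module …, if one denotes the module
structure additively"): read additively, a theta value at the zero label is a torsion class.
[claim: Mochizuki2012, status: disputed] -/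
theorem isOfFinAddOrder_of_mem_thetaValueAt_zero [NeZero twoL] (q : H) {x : H}
    (hx : x ∈ thetaValueAt twoL q 0) : IsOfFinAddOrder (Additive.ofMul x) :=
  (isOfFinAddOrder_ofMul_iff (x := x)).mpr (isOfFinOrder_of_mem_thetaValueAt_zero twoL q hx)

/-- **IUTchII:Cor2.6(ii)** (kurims p. 76 l. 28–31) in abc-iut-L6-t4's currency: read additively, `θ^0` IS the
`μ_{2l}`-orbit `mu2lOrbit 2l 0` of the zero class. [claim: Mochizuki2012, status: disputed] -/
theorem ofMul_image_thetaValueAt_zero [NeZero twoL] (q : H) :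
    Additive.ofMul '' (↑(thetaValueAt twoL q 0) : Set H) = ThetaValueOrbits.mu2lOrbit twoL (0 : Additive H) := by
  rw [ofMul_image_thetaValueAt]
  simp

/-- **IUTchII:Cor2.6(ii)**, "In particular" (kurims p. 76 l. 31–37): the input `hS` of abc-iut-L6-d1's zero-label
splitting (p407386 `ThetaValueOrbits.torsion_restrict_iff` / `zeroLabel_decomp_unique` / `zeroLabel_unit_component`:
"the restriction to `D^δ_{0,μ_-}` kills the theta classes modulo torsion") is DISCHARGED by the first sentence of
Cor. 2.6 (ii): if the restriction `f` to the zero-labelled decomposition group carries every theta class `s ∈ S`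
(`S = ∞θ^ι` or `θ^ι`) to a theta value at the zero label, then `f s` is torsion.
[claim: Mochizuki2012, status: disputed] -/
theorem zeroLabel_hS_of_thetaValueAt_zero [NeZero twoL] {A : Type v} [AddCommGroup A] (f : A →+ Additive H)
    (q : H) {S : Set A} (hval : ∀ s ∈ S, Additive.toMul (f s) ∈ thetaValueAt twoL q 0) :
    ∀ s ∈ S, IsOfFinAddOrder (f s) := fun s hs => by
  have h := isOfFinAddOrder_of_mem_thetaValueAt_zero twoL q (hval s hs)
  rwa [ofMul_toMul] at h

/-- **IUTchII:Cor2.6(ii)** ∘ **IUTchII:Cor1.12(ii)** (kurims p. 76 / p. 57): with `hS` discharged as above, L6-d1's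
mechanism gives the printed splitting clause "the inverse image of the torsion submodule is `∞θ^ι`" directly from
the GIVEN input `hM` (= Cor. 1.12 (i)(c), the unit classes restrict faithfully modulo torsion — a DAG edge to
IUTchII:Cor1.12(i), not a side hypothesis): for `x = m + s`, `f x` is torsion iff `m` is.
[claim: Mochizuki2012, status: disputed] -/
theorem zeroLabel_torsion_restrict_iff_of_thetaValueAt_zero [NeZero twoL] {A : Type v} [AddCommGroup A]
    (f : A →+ Additive H) (q : H) {M : AddSubgroup A} {S : Set A}
    (hM : ∀ m ∈ M, IsOfFinAddOrder (f m) → IsOfFinAddOrder m)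
    (hval : ∀ s ∈ S, Additive.toMul (f s) ∈ thetaValueAt twoL q 0) {m s : A} (hm : m ∈ M) (hs : s ∈ S) :
    IsOfFinAddOrder (f (m + s)) ↔ IsOfFinAddOrder m :=
  ThetaValueOrbits.torsion_restrict_iff f hM (zeroLabel_hS_of_thetaValueAt_zero twoL f q hval) hm hs

/-- **IUTchII:Cor2.6(ii)** ∘ **IUTchII:Cor1.12(ii)** (kurims p. 76 / p. 57), "determines splittings
`M^{×μ}_TM × {∞θ^ι/M^μ_TM}` of `M^×_TM·∞θ^ι/M^μ_TM`": with `hS` discharged by the zero-label theta values, the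
decomposition `x = m + s` is unique modulo torsion in each component (L6-d1's `zeroLabel_decomp_unique`).
[claim: Mochizuki2012, status: disputed] -/
theorem zeroLabel_decomp_unique_of_thetaValueAt_zero [NeZero twoL] {A : Type v} [AddCommGroup A]
    (f : A →+ Additive H) (q : H) {M : AddSubgroup A} {S : Set A}
    (hM : ∀ m ∈ M, IsOfFinAddOrder (f m) → IsOfFinAddOrder m)
    (hval : ∀ s ∈ S, Additive.toMul (f s) ∈ thetaValueAt twoL q 0) {m m' s s' : A} (hm : m ∈ M)
    (hm' : m' ∈ M) (hs : s ∈ S) (hs' : s' ∈ S) (h : m + s = m' + s') :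
    IsOfFinAddOrder (m - m') ∧ IsOfFinAddOrder (s - s') :=
  ThetaValueOrbits.zeroLabel_decomp_unique f hM (zeroLabel_hS_of_thetaValueAt_zero twoL f q hval) hm hm' hs hs' h

end Cor26ii

end Literature.IUT.HodgeArakelov
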